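import Summits.NavierStokesRegularity.NavierStokesRegularity.Theorems.ExtremiserTransiencePinnedDepletionDefs
import Summits.NavierStokesRegularity.NavierStokesRegularity.Theorems.ExtremiserTransiencePinnedDepletionRelayObstruction
import Summits.NavierStokesRegularity.NavierStokesRegularity.Theorems.ExtremiserTransiencePinnedDepletionOneCell
import HarnessLib

/-!
# Crux `NearExtremalTransiencePerFlow` (stmt-NavierStokesRegularity-26567), LINES g13-α `budget_cut` / g13-β `relay`:
# the junction, the cuts and the proved flanks BY NAME

Theorems file (`--supports stmt-NavierStokesRegularity-26567`, helper; prover seat ns-net-p1 g17).  The texts of record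
`…Theorems.ExtremiserTransiencePinnedDepletionDefs` (`CleanLockedWindowAtScale`, `SmallBudgetDepletion`, `CrowdDepletion`,
`PinnedDepletedFraction`, `RelayObstruction`, `CellRelayDecomposition` — VERBATIM §1 of `Lines/budget_cut.lean` ae20d73eeec6 and
`Lines/relay.lean` REV 2 09c2e443f072, ns-idea-5 g13) are definitionally the unfolded hypotheses / conclusions of the kernel facts in
`…PinnedDepletionCleanLockedWindowAtScale`, `…PinnedDepletionSandwich`, `…PinnedDepletionRelayObstruction`; this file restates those
facts BY NAME (every proof is `exact` the unfolded theorem):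

* `cleanLockedWindowAtScale : CleanLockedWindowAtScale` (W♭⁺, flank of both lines — PROVED);
* `relayObstruction : RelayObstruction` (R♭, flank of g13-β — PROVED);
* `nearExtremalTransiencePerFlow_of_pinned : PinnedDepletedFraction → NearExtremalTransiencePerFlow` — **the repaired heart `C′`
  closes the crux BY NAME** (idea-crit-4 g10 15:05:25Z: X♭ `DepletedFraction` misstated as typed, `C′ = PinnedDepletedFraction`);
* `PinnedDepletedFraction.of_budgetCut : SmallBudgetDepletion → CrowdDepletion → PinnedDepletedFraction` and
  `nearExtremalTransiencePerFlow_of_budgetCut' : SmallBudgetDepletion → CrowdDepletion → NearExtremalTransiencePerFlow` (g13-α skeleton);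
* `PinnedDepletedFraction.of_cellRelayDecomposition : CellRelayDecomposition → PinnedDepletedFraction` and
  `nearExtremalTransiencePerFlow_of_cellRelayDecomposition' : CellRelayDecomposition → NearExtremalTransiencePerFlow` (g13-β skeleton);
* `PinnedDepletedFraction.of_strongPinnedDepletion`, `nearExtremalTransiencePerFlow_of_strongPinnedDepletion` — the ONE-CELL
  SANDWICH composed: strong pinned depletion (fixed `δ₀`, efficient fraction `≤ η < 1/2` on every pinned window) ⇒ D♭
  (`CellRelayDecomposition.of_strongPinnedDepletion`, `…PinnedDepletionOneCell`) ⇒ (R♭) junction ⇒ crux;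
* sanity `PinnedDepletedFraction.of_depletedFraction`, `SmallBudgetDepletion.of_depletedFraction`, `CrowdDepletion.of_depletedFraction`:
  the line of record's X♭ implies the junction and both g13-α stubs (the cut asks for LESS); `pinnedDepletedFraction_iff_budgetCut`:
  the budget cut is LOSSLESS (`PinnedDepletedFraction ↔ SmallBudgetDepletion ∧ CrowdDepletion`).

HONEST FRAMING: K♭ (flank, XL), the hearts C♭ / D♭, the junction `PinnedDepletedFraction`, the crux ⟨26567⟩ and NS regularity are
OPEN; nothing about Navier–Stokes regularity or blow-up is proved; no summit is proved by a line. [folklore]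
-/

noncomputable section

open scoped Topology InnerProductSpace RealInnerProductSpace ENNReal ContDiff
open MeasureTheory Filter Set Metric
open Literature.Analysis.FluidPDE
open Summit.NavierStokesRegularity.NavierStokesRegularity.Theses.ExtremiserTransience
open Summit.NavierStokesRegularity.NavierStokesRegularity.Theorems
open Summit.NavierStokesRegularity.NavierStokesRegularity.Theorems.DepletionLadder.KStar.HalfSpace
open Summit.NavierStokesRegularity.NavierStokesRegularity.Theorems.NearExtremalTransiencePerFlow.ZoneTransversality
open Summit.NavierStokesRegularity.NavierStokesRegularity.Theorems.NearExtremalTransiencePerFlow.DepletedFraction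

namespace Summit.NavierStokesRegularity.NavierStokesRegularity.Theorems.NearExtremalTransiencePerFlow.PinnedDepletion

-- the summit's namespace repeats the problem name by convention (D-0017)
set_option linter.dupNamespace false

/-- **W♭⁺ BY NAME**: `CleanLockedWindowAtScale` holds (by `cleanLockedWindowAtScale_holds`). [folklore] -/
theorem cleanLockedWindowAtScale : CleanLockedWindowAtScale := cleanLockedWindowAtScale_holds

/-- **R♭ BY NAME**: `RelayObstruction` holds (by `relayObstruction_holds`). [folklore] -/
theorem relayObstruction : RelayObstruction := relayObstruction_holds

/-- **The repaired heart closes the crux BY NAME**: `PinnedDepletedFraction → NearExtremalTransiencePerFlow`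
(by `nearExtremalTransiencePerFlow_of_pinnedDepletedFraction`, the pinned sandwich through W♭⁺). [folklore] -/
theorem nearExtremalTransiencePerFlow_of_pinned (hX : PinnedDepletedFraction) : NearExtremalTransiencePerFlow :=
  nearExtremalTransiencePerFlow_of_pinnedDepletedFraction hX

/-- **The budget cut BY NAME** (g13-α): `SmallBudgetDepletion → CrowdDepletion → PinnedDepletedFraction`
(by `pinnedDepletedFraction_of_budgetCut`). [folklore] -/
theorem PinnedDepletedFraction.of_budgetCut (hK : SmallBudgetDepletion) (hC : CrowdDepletion) : PinnedDepletedFraction :=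
  pinnedDepletedFraction_of_budgetCut hK hC

/-- **LINE g13-α `budget_cut` skeleton BY NAME**: K♭ and C♭ conclude the crux (= `NearExtremalTransiencePerFlow_of hK hC` of the
workfile). [folklore] -/
theorem nearExtremalTransiencePerFlow_of_budgetCut' (hK : SmallBudgetDepletion) (hC : CrowdDepletion) :
    NearExtremalTransiencePerFlow :=
  nearExtremalTransiencePerFlow_of_pinned (PinnedDepletedFraction.of_budgetCut hK hC)

/-- **The relay cut BY NAME** (g13-β): `CellRelayDecomposition → PinnedDepletedFraction` (R♭ discharged;
by `pinnedDepletedFraction_of_cellRelayDecomposition`). [folklore] -/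
theorem PinnedDepletedFraction.of_cellRelayDecomposition (hD : CellRelayDecomposition) : PinnedDepletedFraction :=
  pinnedDepletedFraction_of_cellRelayDecomposition hD

/-- **LINE g13-β `relay` skeleton BY NAME**: the heart D♭ concludes the crux (= `NearExtremalTransiencePerFlow_of_heart hD` of the
workfile). [folklore] -/
theorem nearExtremalTransiencePerFlow_of_cellRelayDecomposition' (hD : CellRelayDecomposition) :
    NearExtremalTransiencePerFlow :=
  nearExtremalTransiencePerFlow_of_pinned (PinnedDepletedFraction.of_cellRelayDecomposition hD)

/-- Sanity BY NAME: the line of record's heart X♭ `DepletedFraction` implies the junction (the repair asks for LESS). [folklore] -/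
theorem PinnedDepletedFraction.of_depletedFraction (hX : DepletedFraction) : PinnedDepletedFraction :=
  pinnedDepletedFraction_of_depletedFraction hX

/-- Sanity BY NAME: X♭ ⇒ K♭ (drop the budget hypothesis). [folklore] -/
theorem SmallBudgetDepletion.of_depletedFraction (hX : DepletedFraction) : SmallBudgetDepletion := by
  intro C ν T u p hV Θ G H τ₁ N₀ hΘ hG hH hτ₁ _hN₀
  obtain ⟨ε, hε, h1⟩ := PinnedDepletedFraction.of_depletedFraction hX C ν T u p hV Θ G H τ₁ hΘ hG hH hτ₁
  exact ⟨ε, hε, fun t M ht hM htT hpin hMb hlock hgrad hheights _ => h1 t M ht hM htT hpin hMb hlock hgrad hheights⟩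

/-- Sanity BY NAME: X♭ ⇒ C♭ (drop the budget hypothesis; any `N₀`). [folklore] -/
theorem CrowdDepletion.of_depletedFraction (hX : DepletedFraction) : CrowdDepletion := by
  intro C ν T u p hV Θ G H τ₁ hΘ hG hH hτ₁
  obtain ⟨ε, hε, h1⟩ := PinnedDepletedFraction.of_depletedFraction hX C ν T u p hV Θ G H τ₁ hΘ hG hH hτ₁
  exact ⟨1, ε, one_pos, hε, fun t M ht hM htT hpin hMb hlock hgrad hheights _ => h1 t M ht hM htT hpin hMb hlock hgrad hheights⟩

/-- Sanity BY NAME: K♭ is implied by the junction (forget the budget hypothesis). [folklore] -/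
theorem SmallBudgetDepletion.of_pinned (hX : PinnedDepletedFraction) : SmallBudgetDepletion := by
  intro C ν T u p hV Θ G H τ₁ N₀ hΘ hG hH hτ₁ _hN₀
  obtain ⟨ε, hε, h1⟩ := hX C ν T u p hV Θ G H τ₁ hΘ hG hH hτ₁
  exact ⟨ε, hε, fun t M ht hM htT hpin hMb hlock hgrad hheights _ => h1 t M ht hM htT hpin hMb hlock hgrad hheights⟩

/-- Sanity BY NAME: C♭ is implied by the junction — so `PinnedDepletedFraction ↔ SmallBudgetDepletion ∧ CrowdDepletion`
(the budget cut is lossless). [folklore] -/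
theorem CrowdDepletion.of_pinned (hX : PinnedDepletedFraction) : CrowdDepletion := by
  intro C ν T u p hV Θ G H τ₁ hΘ hG hH hτ₁
  obtain ⟨ε, hε, h1⟩ := hX C ν T u p hV Θ G H τ₁ hΘ hG hH hτ₁
  exact ⟨1, ε, one_pos, hε, fun t M ht hM htT hpin hMb hlock hgrad hheights _ => h1 t M ht hM htT hpin hMb hlock hgrad hheights⟩

/-- **The budget cut is LOSSLESS**: `PinnedDepletedFraction ↔ SmallBudgetDepletion ∧ CrowdDepletion`. [folklore] -/
theorem pinnedDepletedFraction_iff_budgetCut : PinnedDepletedFraction ↔ SmallBudgetDepletion ∧ CrowdDepletion :=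
  ⟨fun h => ⟨SmallBudgetDepletion.of_pinned h, CrowdDepletion.of_pinned h⟩, fun h => PinnedDepletedFraction.of_budgetCut h.1 h.2⟩

/-- **The one-cell sandwich composed, BY NAME**: strong pinned depletion (per violator and window package a FIXED margin
`0 < δ₀ ≤ κ⋆` and `η ≥ 0`, `2η < 1`, with the `(κ⋆ − δ₀)`-efficient times of measure `≤ η|I|` on every pinned admissible window)
implies the junction `PinnedDepletedFraction` — through D♭ (`CellRelayDecomposition.of_strongPinnedDepletion`) and R♭
(`PinnedDepletedFraction.of_cellRelayDecomposition`). [folklore] -/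
theorem PinnedDepletedFraction.of_strongPinnedDepletion
    (h : ∀ (C ν T : ℝ) (u : ℝ → EuclideanSpace ℝ (Fin 3) → EuclideanSpace ℝ (Fin 3)) (p : ℝ → EuclideanSpace ℝ (Fin 3) → ℝ),
      IsViolator C ν T u p →
      ∀ (Θ G H τ₁ : ℝ), 0 < Θ → 0 < G → 0 < H → 0 < τ₁ →
      ∃ δ₀ η : ℝ, 0 < δ₀ ∧ δ₀ ≤ kStar ∧ 0 ≤ η ∧ 2 * η < 1 ∧
      ∀ (t M : ℝ), 0 ≤ t → 0 < M → t + τ₁ * ν / M ^ 2 < T → M = C * Real.sqrt ν / Real.sqrt (T - t) →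
        (∀ x, ‖u t x‖ ≤ M) →
        (∫ x, ‖curl (u t) x‖ ^ 2) ≤ Θ * (ν / M) ^ 2 * (∫ x, frobeniusNormSq (fderiv ℝ (curl (u t)) x)) →
        (∀ x, ‖fderiv ℝ (u t) x‖ ≤ G * M ^ 2 / ν) →
        (∀ t' ∈ Set.Icc t (t + τ₁ * ν / M ^ 2), ∀ x, ‖u t' x‖ ≤ H * M) →
        volume ({t' : ℝ | ∃ M' : ℝ, (∀ x, ‖u t' x‖ ≤ M') ∧
            (kStar - δ₀) * M' * Real.sqrt (∫ x, ‖curl (u t') x‖ ^ 2) *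
              Real.sqrt (∫ x, frobeniusNormSq (fderiv ℝ (curl (u t')) x)) <
            |∫ x, ⟪curl (u t') x, fderiv ℝ (u t') x (curl (u t') x)⟫_ℝ|} ∩
          Set.Icc t (t + τ₁ * ν / M ^ 2)) ≤ ENNReal.ofReal (η * (τ₁ * ν / M ^ 2))) :
    PinnedDepletedFraction :=
  PinnedDepletedFraction.of_cellRelayDecomposition (CellRelayDecomposition.of_strongPinnedDepletion h)

/-- **Strong pinned depletion closes the crux BY NAME** (one-cell sandwich, relay cut, pinned sandwich). [folklore] -/
theorem nearExtremalTransiencePerFlow_of_strongPinnedDepletion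
    (h : ∀ (C ν T : ℝ) (u : ℝ → EuclideanSpace ℝ (Fin 3) → EuclideanSpace ℝ (Fin 3)) (p : ℝ → EuclideanSpace ℝ (Fin 3) → ℝ),
      IsViolator C ν T u p →
      ∀ (Θ G H τ₁ : ℝ), 0 < Θ → 0 < G → 0 < H → 0 < τ₁ →
      ∃ δ₀ η : ℝ, 0 < δ₀ ∧ δ₀ ≤ kStar ∧ 0 ≤ η ∧ 2 * η < 1 ∧
      ∀ (t M : ℝ), 0 ≤ t → 0 < M → t + τ₁ * ν / M ^ 2 < T → M = C * Real.sqrt ν / Real.sqrt (T - t) →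
        (∀ x, ‖u t x‖ ≤ M) →
        (∫ x, ‖curl (u t) x‖ ^ 2) ≤ Θ * (ν / M) ^ 2 * (∫ x, frobeniusNormSq (fderiv ℝ (curl (u t)) x)) →
        (∀ x, ‖fderiv ℝ (u t) x‖ ≤ G * M ^ 2 / ν) →
        (∀ t' ∈ Set.Icc t (t + τ₁ * ν / M ^ 2), ∀ x, ‖u t' x‖ ≤ H * M) →
        volume ({t' : ℝ | ∃ M' : ℝ, (∀ x, ‖u t' x‖ ≤ M') ∧
            (kStar - δ₀) * M' * Real.sqrt (∫ x, ‖curl (u t') x‖ ^ 2) *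
              Real.sqrt (∫ x, frobeniusNormSq (fderiv ℝ (curl (u t')) x)) <
            |∫ x, ⟪curl (u t') x, fderiv ℝ (u t') x (curl (u t') x)⟫_ℝ|} ∩
          Set.Icc t (t + τ₁ * ν / M ^ 2)) ≤ ENNReal.ofReal (η * (τ₁ * ν / M ^ 2))) :
    NearExtremalTransiencePerFlow :=
  nearExtremalTransiencePerFlow_of_pinned (PinnedDepletedFraction.of_strongPinnedDepletion h)

end Summit.NavierStokesRegularity.NavierStokesRegularity.Theorems.NearExtremalTransiencePerFlow.PinnedDepletion

end
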